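import Summits.QuantumFields.BalabanUV.T4Continuum.Support.NE3CovariantWeitzenbock
import Summits.QuantumFields.BalabanUV.T4Continuum.Support.NE3DiscreteGradientEstimate
import HarnessLib

/-!
# NE7CovariantInteriorGradient — THE CURVED TWIN OF R37 ∕ (156): the lattice INTERIOR GRADIENT ESTIMATE for a site-framed `𝔤`-valued field at a
# UNITARY SMALL-FIELD BACKGROUND `V` — `‖∇_V f‖ ≤ 2·(d·U∕R + R·(B + 4d(dR+1)·a·U))` from the sup `U` of `f`, the sup `B` of its ROUGH COVARIANT
# LAPLACIAN `Σ_i (∇_i + ∇_i^†) f`, and the plaquette radius `a` of `V`, every radius `R ≥ 1`; file 47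

Cell `pub-balaban`, rung (B)+1 sub-cell t4, lineage `b2b-balaban-t4-ne7-p1` (CRUX PROVER NE7 #1 = OWNER of row NE7), generation 79; memo
`t4/b2b-balaban-t4-ne7-p1-g78/BUMP-CLASS-FLAT.md` §7 POINTER (the letter `α₁^Z` of road (B)'s sharp form F115 `NE7ApeCurvedRepRoadBSharp`: the gradient member of E′'s
Landau representative `Z` at the CURVED background `W`).  File F116 (over row NE3's R37 `NE3DiscreteGradientEstimate.norm_sub_le_of_laplacian` — [Gilbarg–Trudinger
Thm 3.9] on `ℤᵈ` for normed-space-valued functions — and the leaf kit `NE3CovariantCalculus` (`cD`, `cDstar`); the axial gauge of [Balaban1985Averaging] p. 24 BY NAME: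
`B7Prop1Explicit.axialFn`, `B7Prop1Explicit.axial_bond_bound`).
WHY.  Lineage #2's chain (156)–(159) derives the gradient currency of a representative from its sup, the flux divergence and the Landau reaction AT THE FLAT BACKGROUND, the
engine being R37's interior estimate for the FLAT lattice Laplacian.  At a curved background `V` (arbitrary unitary bonds, plaquettes within `a` of `1`) the flat
Laplacian of `f` is not close to the covariant one — but it is in the AXIAL GAUGE rooted at the point `x₀` under study: there every bond `b = (y, μ)` is within
`|y − x₀|₁·a` of `1` (`axial_bond_bound`), so on the sup-cube of radius `R` the flat Laplacian of the gauged field `f₀ = Ad_{v}f` differs from `Ad_{v}(Δ_V f)` by at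
most `4d(dR+1)·a·U`, R37 applies to `f₀`, and at the root the gauged covariant difference IS the flat difference (`V₀(x₀, x₀+e_τ) = 1`).  Gauge covariance
(`‖∇_{V₀} f₀‖ = ‖∇_V f‖`) returns the estimate to `V`.  No regularity of `V` beyond its plaquette radius is spent; the price of curvature is the zeroth-order term
`8d(dR+1)R·a·U` (with `R = M`, `a = x`: `O(d²·M²x·U)`, a level-uniform small multiple of the sup).
WHAT ([folklore]; 0 def, 0 sorry).  §1 gauge covariance of `cD`, `cDstar` and of the rough covariant Laplacian on site-framed fields (`f ↦ Ad_{v(·)} f`, `V ↦ V^{v}`).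
§2 `flatLap_gauged_eq`: the flat Laplacian of `Ad_v f` = `Ad_{v}(Σ_i(∇_i + ∇_i^†)f)` minus the bond defects `(Ad_{V^v(b)} − 1)(…)`; `l1` bookkeeping on the sup-cube.
§3 THE END **`norm_cD_le_of_covLap`**: for unitary `V` with `SmallField V a`, `‖f‖ ≤ U` and `‖Σ_i (cD V i f + cDstar V i f)‖ ≤ B` everywhere, every `R ≥ 1`, every
site `x₀` and direction `τ`: `‖cD V τ f x₀‖ ≤ 2·(d·U∕R + R·(B + 4d(dR+1)·a·U))`; §4 the direction-field reading **`norm_covFd_le_of_covLap`** (`covFd V ψ x μ ν`, the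
`ν`-component framed at sites by `NE3CovariantWeitzenbock.frame`).
HONEST FRAMING (page 1): elementary lattice analysis of OUR objects at ONE unitary configuration; nothing of Bałaban's asserted ([Balaban1985Averaging] p. 24 is the TEXT
LOCATION of the axial gauge, used BY NAME through lit-balaban's transcription); no Landau gauge, no minimiser; `α₁^Z` NOT yet discharged (files F117–F120 dock this to
the covariant Hodge identity, the plaquette factorisation and E′); (APE) on curved data NOT proved; NOT ONE-STEP, NOT NE7; spine 0∕9; finite T⁴ rung (B)+1 — NOT infinite
volume, NOT mass gap, NOT `BetaPertH`, NOT Clay.  Continuum YM on T⁴ ⇐ BetaPertH ∧ nine spine estimates (0/9 proved); BetaPertH ⇐ (D1) ∧ (D4) ∧ CAP+tail; G-an2-4 gates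
asym, D1 and NE2/3/4.
-/

set_option autoImplicit false

open scoped BigOperators Matrix Matrix.Norms.L2Operator
open NormedSpace Finset

namespace Summit.QuantumFields.BalabanUV.T4Continuum.NE7CovariantInteriorGradient

open Literature.MathematicalPhysics.QuantumFieldTheory.Balaban1983to89
open B7Prop1Explicit B7Prop2Explicit
open T4AveragingDeficitWall (Ad IsUnitaryCfg SmallField)
open T4AveragingDeficitNonAbelian (Ad_mul Ad_sub)
open AveragingDeficitTransport (norm_Ad_of_unitary mem_U1_of_unitary)
open AveragingDeficitNearIdentity (Ad_one Ad_add Ad_sum norm_Ad_sub_le)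
open AveragingDeficitCovGrad (covFd norm_Ad_inv_sub_le)
open NE3CovariantCalculus (cD cDstar)
open NE3CovariantWeitzenbock (frame cD_frame norm_frame)
open NE3DiscreteGradientEstimate (norm_sub_le_of_laplacian)

noncomputable section

variable {d : ℕ} {n : Type*} [Fintype n] [DecidableEq n]


/-! ## §1 Gauge covariance of the covariant differences of site-framed fields -/

/-- `∇_{V^v,μ}(Ad_v f)(x) = Ad_{v(x)}(∇_{V,μ} f)(x)`. [folklore] -/
theorem cD_gaugeAct (v : Site d → (Matrix n n ℂ)ˣ) (V : Site d → Fin d → (Matrix n n ℂ)ˣ) (f : Site d → Matrix n n ℂ) (μ : Fin d) (x : Site d) :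
    cD (gaugeAct v V) μ (fun y => Ad (v y) (f y)) x = Ad (v x) (cD V μ f x) := by
  unfold cD
  rw [Ad_sub, ← Ad_mul, ← Ad_mul]
  congr 2
  unfold gaugeAct
  group

/-- `∇^†_{V^v,μ}(Ad_v g)(x) = Ad_{v(x)}(∇^†_{V,μ} g)(x)`. [folklore] -/
theorem cDstar_gaugeAct (v : Site d → (Matrix n n ℂ)ˣ) (V : Site d → Fin d → (Matrix n n ℂ)ˣ) (g : Site d → Matrix n n ℂ) (μ : Fin d) (x : Site d) :
    cDstar (gaugeAct v V) μ (fun y => Ad (v y) (g y)) x = Ad (v x) (cDstar V μ g x) := by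
  unfold cDstar
  rw [Ad_sub, ← Ad_mul, ← Ad_mul]
  congr 2
  unfold gaugeAct
  rw [sub_add_cancel]
  group

/-- The rough covariant Laplacian `Σ_i (∇_i + ∇_i^†)` is gauge COVARIANT on site-framed fields. [folklore] -/
theorem covLap_gaugeAct (v : Site d → (Matrix n n ℂ)ˣ) (V : Site d → Fin d → (Matrix n n ℂ)ˣ) (f : Site d → Matrix n n ℂ) (x : Site d) :
    ∑ i, (cD (gaugeAct v V) i (fun y => Ad (v y) (f y)) x + cDstar (gaugeAct v V) i (fun y => Ad (v y) (f y)) x)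
      = Ad (v x) (∑ i, (cD V i f x + cDstar V i f x)) := by
  rw [Ad_sum]
  refine Finset.sum_congr rfl fun i _ => ?_
  rw [cD_gaugeAct, cDstar_gaugeAct, Ad_add]

/-! ## §2 The flat Laplacian of the gauged field against the covariant Laplacian; `ℓ¹` bookkeeping on the sup-cube -/

/-- **FLAT = COVARIANT − BOND DEFECTS** for the gauged field `f₀ = Ad_v f` at the gauged background `V₀ = V^v`:
`Σ_i [(f₀(y+e_i) − f₀ y) − (f₀ y − f₀(y−e_i))] = Ad_{v(y)}(Σ_i (∇_i + ∇_i^†) f (y)) − Σ_i [(Ad_{V₀(y,i)} − 1) f₀(y+e_i) + (Ad_{V₀(y−e_i,i)⁻¹} − 1) f₀(y−e_i)]`.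
[folklore] -/
theorem flatLap_gauged_eq (v : Site d → (Matrix n n ℂ)ˣ) (V : Site d → Fin d → (Matrix n n ℂ)ˣ) (f : Site d → Matrix n n ℂ) (y : Site d) :
    ∑ i, ((Ad (v (y + e i)) (f (y + e i)) - Ad (v y) (f y)) - (Ad (v y) (f y) - Ad (v (y - e i)) (f (y - e i))))
      = Ad (v y) (∑ i, (cD V i f y + cDstar V i f y))
        - ∑ i, ((Ad (gaugeAct v V y i) (Ad (v (y + e i)) (f (y + e i))) - Ad (v (y + e i)) (f (y + e i)))
            + (Ad (gaugeAct v V (y - e i) i)⁻¹ (Ad (v (y - e i)) (f (y - e i))) - Ad (v (y - e i)) (f (y - e i)))) := by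
  rw [Ad_sum, ← Finset.sum_sub_distrib]
  refine Finset.sum_congr rfl fun i _ => ?_
  have ht1 : Ad (gaugeAct v V y i) (Ad (v (y + e i)) (f (y + e i))) = Ad (v y) (Ad (V y i) (f (y + e i))) := by
    rw [← Ad_mul, ← Ad_mul]
    congr 1
    unfold gaugeAct
    group
  have ht2 : Ad (gaugeAct v V (y - e i) i)⁻¹ (Ad (v (y - e i)) (f (y - e i))) = Ad (v y) (Ad (V (y - e i) i)⁻¹ (f (y - e i))) := by
    rw [← Ad_mul, ← Ad_mul]
    congr 1
    unfold gaugeAct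
    rw [sub_add_cancel]
    group
  rw [ht1, ht2]
  simp only [cD, cDstar, Ad_add, Ad_sub]
  abel

omit [Fintype n] [DecidableEq n] in
/-- On the sup-cube `{|y_i − x₀,i| ≤ R}`: `|y − x₀|₁ ≤ d·R`. [folklore] -/
theorem l1_le_of_cube {x₀ y : Site d} {R : ℕ} (hy : ∀ i, |y i - x₀ i| ≤ (R : ℤ)) : (l1 (y - x₀) : ℝ) ≤ (d : ℝ) * R := by
  have h : l1 (y - x₀) ≤ d * R := by
    unfold l1
    calc ∑ κ, ((y - x₀) κ).natAbs ≤ ∑ _κ : Fin d, R := Finset.sum_le_sum fun κ _ => by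
            have h := hy κ
            rw [Int.abs_eq_natAbs] at h
            simp only [Pi.sub_apply]
            exact_mod_cast h
      _ = d * R := by rw [Finset.sum_const, Finset.card_univ, Fintype.card_fin, smul_eq_mul]
  exact_mod_cast h

omit [Fintype n] [DecidableEq n] in
/-- On the sup-cube: `|y − e_i − x₀|₁ ≤ d·R + 1`. [folklore] -/
theorem l1_sub_e_le_of_cube {x₀ y : Site d} {R : ℕ} (hy : ∀ i, |y i - x₀ i| ≤ (R : ℤ)) (i : Fin d) :
    (l1 (y - e i - x₀) : ℝ) ≤ (d : ℝ) * R + 1 := by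
  have h1 : l1 (y - e i - x₀) ≤ l1 (y - x₀) + l1 (-(e i) : Site d) := by
    rw [show y - e i - x₀ = (y - x₀) + -(e i) by abel]
    exact l1_add_le _ _
  have h2 : l1 (-(e i) : Site d) = 1 := by
    rw [l1_neg]
    have h := l1_zsmul_e (d := d) 1 i
    rwa [one_smul] at h
  rw [h2] at h1
  have h3 : (l1 (y - e i - x₀) : ℝ) ≤ (l1 (y - x₀) : ℝ) + 1 := by exact_mod_cast h1
  exact h3.trans (by linarith [l1_le_of_cube (d := d) hy])

/-! ## §3 THE END: the covariant interior gradient estimate -/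

/-- **THE COVARIANT LATTICE INTERIOR GRADIENT ESTIMATE.**  For a unitary configuration `V` on `ℤᵈ` with every plaquette within `a` of `1` (`SmallField V a`), a
site-framed field `f : ℤᵈ → 𝕄` with `‖f‖ ≤ U` everywhere and rough covariant Laplacian `‖Σ_i (∇_{V,i} + ∇_{V,i}^†) f‖ ≤ B` everywhere, every radius `R ≥ 1`, every
site `x₀` and direction `τ`: `‖∇_{V,τ} f (x₀)‖ = ‖Ad_{V(x₀,τ)} f(x₀+e_τ) − f(x₀)‖ ≤ 2·(d·U∕R + R·(B + 4d(dR+1)·a·U))` — R37 in the axial gauge rooted at `x₀`.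
[folklore] -/
theorem norm_cD_le_of_covLap [Nonempty n] {V : Site d → Fin d → (Matrix n n ℂ)ˣ} (hV : IsUnitaryCfg V) {a : ℝ} (ha : 0 ≤ a) (hVa : SmallField V a)
    (f : Site d → Matrix n n ℂ) {U B : ℝ} (hU : ∀ y, ‖f y‖ ≤ U) (hB : ∀ y, ‖∑ i, (cD V i f y + cDstar V i f y)‖ ≤ B)
    {R : ℕ} (hR : 1 ≤ R) (x₀ : Site d) (τ : Fin d) :
    ‖cD V τ f x₀‖ ≤ 2 * ((d : ℝ) * U / R + R * (B + 4 * d * ((d : ℝ) * R + 1) * a * U)) := by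
  -- the axial gauge rooted at `x₀`
  set v : Site d → (Matrix n n ℂ)ˣ := axialFn V x₀ with hv
  have hV1 : ∀ x κ, V x κ ∈ U1 (Matrix n n ℂ) := fun x κ => mem_U1_of_unitary (hV x κ)
  have hvu : ∀ y, v y ∈ unitaryUnits (Matrix n n ℂ) := fun y => hol_mem_of hV _ _
  have hV₀u : ∀ y μ, gaugeAct v V y μ ∈ unitaryUnits (Matrix n n ℂ) := fun y μ =>
    (unitaryUnits (Matrix n n ℂ)).mul_mem ((unitaryUnits (Matrix n n ℂ)).mul_mem (hvu _) (hV _ _)) ((unitaryUnits (Matrix n n ℂ)).inv_mem (hvu _))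
  have hbond : ∀ (y : Site d) (μ : Fin d), ‖((gaugeAct v V y μ : (Matrix n n ℂ)ˣ) : Matrix n n ℂ) - 1‖ ≤ l1 (y - x₀) * a :=
    fun y μ => axial_bond_bound V hV1 x₀ hVa ha y μ
  have hU0 : 0 ≤ U := (norm_nonneg _).trans (hU x₀)
  -- the gauged field and its flat Laplacian on the sup-cube
  set f₀ : Site d → Matrix n n ℂ := fun y => Ad (v y) (f y) with hf₀
  have hU' : ∀ y : Site d, (∀ i, |y i - x₀ i| ≤ (R : ℤ)) → ‖f₀ y‖ ≤ U := fun y _ => by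
    rw [hf₀, norm_Ad_of_unitary (hvu y)]; exact hU y
  have hB' : ∀ y : Site d, (∀ i, |y i - x₀ i| ≤ (R : ℤ)) →
      ‖∑ i, ((f₀ (y + e i) - f₀ y) - (f₀ y - f₀ (y - e i)))‖ ≤ B + 4 * d * ((d : ℝ) * R + 1) * a * U := by
    intro y hy
    have hid := flatLap_gauged_eq v V f y
    simp only [hf₀]
    rw [hid]
    refine (norm_sub_le _ _).trans (add_le_add ?_ ?_)
    · rw [norm_Ad_of_unitary (hvu y)]; exact hB y
    · refine (norm_sum_le _ _).trans ?_
      have hyl := l1_le_of_cube (d := d) hy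
      have hterm : ∀ i : Fin d,
          ‖(Ad (gaugeAct v V y i) (Ad (v (y + e i)) (f (y + e i))) - Ad (v (y + e i)) (f (y + e i)))
              + (Ad (gaugeAct v V (y - e i) i)⁻¹ (Ad (v (y - e i)) (f (y - e i))) - Ad (v (y - e i)) (f (y - e i)))‖
            ≤ 4 * ((d : ℝ) * R + 1) * a * U := by
        intro i
        have hyl' := l1_sub_e_le_of_cube (d := d) hy i
        have h1 : ‖Ad (gaugeAct v V y i) (Ad (v (y + e i)) (f (y + e i))) - Ad (v (y + e i)) (f (y + e i))‖
            ≤ 2 * ((d : ℝ) * R * a) * U := by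
          refine (norm_Ad_sub_le (hV₀u y i) _).trans ?_
          rw [norm_Ad_of_unitary (hvu _)]
          have hb := (hbond y i).trans (mul_le_mul_of_nonneg_right hyl ha)
          gcongr
          exact hU _
        have h2 : ‖Ad (gaugeAct v V (y - e i) i)⁻¹ (Ad (v (y - e i)) (f (y - e i))) - Ad (v (y - e i)) (f (y - e i))‖
            ≤ 2 * (((d : ℝ) * R + 1) * a) * U := by
          refine (norm_Ad_inv_sub_le (hV₀u (y - e i) i) _).trans ?_
          rw [norm_Ad_of_unitary (hvu _)]
          have hb := (hbond (y - e i) i).trans (mul_le_mul_of_nonneg_right hyl' ha)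
          gcongr
          exact hU _
        refine (norm_add_le _ _).trans ?_
        have hR0 : (0 : ℝ) ≤ (d : ℝ) * R * a * U := by positivity
        nlinarith [h1, h2, hR0, ha, hU0]
      calc ∑ i, ‖(Ad (gaugeAct v V y i) (Ad (v (y + e i)) (f (y + e i))) - Ad (v (y + e i)) (f (y + e i)))
              + (Ad (gaugeAct v V (y - e i) i)⁻¹ (Ad (v (y - e i)) (f (y - e i))) - Ad (v (y - e i)) (f (y - e i)))‖
          ≤ ∑ _i : Fin d, 4 * ((d : ℝ) * R + 1) * a * U := Finset.sum_le_sum fun i _ => hterm i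
        _ = 4 * d * ((d : ℝ) * R + 1) * a * U := by
          rw [Finset.sum_const, Finset.card_univ, Fintype.card_fin, nsmul_eq_mul]; ring
  -- R37 for the gauged field
  have hmain := norm_sub_le_of_laplacian x₀ τ hR f₀ hU' hB'
  -- at the root the gauged covariant difference is the flat one: `v(x₀) = 1`, `v(x₀ + e_τ) = V(x₀, τ)`
  have hvx₀ : v x₀ = 1 := by
    rw [hv, axialFn, sub_self, treeWord_zero, hol_nil]
  have h0 : ‖((gaugeAct v V x₀ τ : (Matrix n n ℂ)ˣ) : Matrix n n ℂ) - 1‖ ≤ 0 := by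
    have h := hbond x₀ τ
    have hl : l1 (x₀ - x₀) = 0 := by rw [sub_self]; simp [l1]
    rwa [hl, Nat.cast_zero, zero_mul] at h
  have h1 : gaugeAct v V x₀ τ = 1 := by
    rw [norm_le_zero_iff, sub_eq_zero] at h0
    exact Units.val_eq_one.mp h0
  have hve : v (x₀ + e τ) = V x₀ τ := by
    unfold gaugeAct at h1
    rw [hvx₀, one_mul, mul_inv_eq_one] at h1
    exact h1.symm
  have hcD : cD V τ f x₀ = f₀ (x₀ + e τ) - f₀ x₀ := by
    simp only [hf₀, cD]
    rw [hve, hvx₀, Ad_one]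
  rw [hcD]
  exact hmain

/-! ## §4 The direction-field reading -/

/-- **THE COVARIANT INTERIOR GRADIENT ESTIMATE FOR A DIRECTION FIELD** (END-framed `ψ`, the convention `V_s = V·e^{sψ}`): with `f = frame V ψ · ν` (the
`ν`-component transported to the sites), `‖f‖ = ‖ψ(·,ν)‖`, and `covFd V ψ x μ ν = ∇_{V,μ} f (x)` (`NE3CovariantWeitzenbock.cD_frame`): under `‖ψ(y,ν)‖ ≤ U` and
`‖Σ_i (∇_i + ∇_i^†)(frame V ψ · ν)‖ ≤ B` everywhere, `‖covFd V ψ x₀ μ ν‖ ≤ 2·(d·U∕R + R·(B + 4d(dR+1)·a·U))`. [folklore] -/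
theorem norm_covFd_le_of_covLap [Nonempty n] {V : Site d → Fin d → (Matrix n n ℂ)ˣ} (hV : IsUnitaryCfg V) {a : ℝ} (ha : 0 ≤ a) (hVa : SmallField V a)
    (ψ : Site d → Fin d → Matrix n n ℂ) (ν : Fin d) {U B : ℝ} (hU : ∀ y, ‖ψ y ν‖ ≤ U)
    (hB : ∀ y, ‖∑ i, (cD V i (fun z => frame V ψ z ν) y + cDstar V i (fun z => frame V ψ z ν) y)‖ ≤ B)
    {R : ℕ} (hR : 1 ≤ R) (x₀ : Site d) (μ : Fin d) :
    ‖covFd V ψ x₀ μ ν‖ ≤ 2 * ((d : ℝ) * U / R + R * (B + 4 * d * ((d : ℝ) * R + 1) * a * U)) := by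
  rw [← cD_frame]
  exact norm_cD_le_of_covLap hV ha hVa (fun z => frame V ψ z ν) (fun y => by rw [norm_frame hV]; exact hU y) hB hR x₀ μ

end

end Summit.QuantumFields.BalabanUV.T4Continuum.NE7CovariantInteriorGradient
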